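import Summits.BirchSwinnertonDyer.BirchSwinnertonDyer.Theorems.KatoDescentPotSupersingularWildFineSelmerFineUnitAnchorTamagawa
import Summits.BirchSwinnertonDyer.BirchSwinnertonDyer.Theorems.KatoDescentTamePotSupersingularTameFineSelmerFineUnitAnchor
import HarnessLib

/-!
# Route `KatoDescentTamePotSupersingular` (rung K8-t′, cell `bsd-potss`): the FINE UNIT-ANCHOR road with the
# TAMAGAWA socket for the (t′) Conj-A crux `TameFineSelmerCoatesSujatha` (item stmt-BirchSwinnertonDyer-19413)
# at an odd additive potentially-good prime `p` — twin of the K9 file `…WildFineSelmerFineUnitAnchorTamagawa.lean`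
# (a `--supports … --as helper` file; seat `bsd-potss-k9-c4` g6, courtesy for `bsd-potss-k8t-c4`;
# ROUTE-FREE; nothing booked, BSD is not proved by any of this)

WHY. As in the K9 twin: `p ∤ c_v` discharges the classical level-`0` local tower kernel at every `v ∤ p`
(tree bound `LocalTowerKernelCardLeTamagawa`, any reduction type), so the per-row certificate of the fine
unit-anchor road on a (t′) row reads: ONE `E[p]`-congruent elliptic `W′` of ANY reduction type at `p` (the
census says all partners of (t′) rows are additive at `p`) with `rank 0`, `#Ш(W′)[p^∞] = 1`, `p ∤ ∏ c_ℓ(W′)`,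
and no non-zero `D_v`-fixed `p`-torsion of `W′[p^∞]` at the place above `p` (`W′(ℚ_p)[p] = 0`, a ROW test).

* **`missingUpperBoundAt_addv_of_fineUnitAnchor_tamagawa`** (+ `_analytic`: `r_an(W′) = 0`, `p ∤ #Ш(W′)`,
  `p ∤ ∏ c_ℓ(W′)`), class form `tameFineSelmerCoatesSujatha_of_fineTamagawaAnchorCertificates`.

HONEST FRAMING: conditional-results on the ROW side's named facts (typed in the tree; no new fact); the anchor
side is unconditional; per-row data are hypotheses; item 19413 NOT closed; class-wide (A) is a named open
problem. References: [GreenbergLNM1716] Prop. 3.8 (pp. 95–96), §3 Lemma 3.3; [LimSujatha2018] §3 Prop. 3.2;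
[Kato2004Asterisque] Thm. 14.5 (3), Prop. 14.16 (2); [CoatesSujatha2005] §3.
-/

set_option autoImplicit false
-- sibling precedent (`KatoDescentPotSupersingularAssembly.lean`): the directory name repeats the summit name
set_option linter.dupNamespace false

noncomputable section

open scoped Classical

universe u

namespace Summit.BirchSwinnertonDyer.BirchSwinnertonDyer.Theorems.TameFineSelmerFineUnitAnchorTamagawa

open NumberField IsDedekindDomain Field
open WeierstrassCurve Literature.NumberTheory.EllipticCurves
  Literature.NumberTheory.EllipticCurves.GreenbergSelmer
  Literature.NumberTheory.EllipticCurves.IwasawaAlgebra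
  Literature.NumberTheory.EllipticCurves.Rank1Residual
  Literature.NumberTheory.EllipticCurves.Rank1Residual.Typed
  Literature.NumberTheory.EllipticCurves.ZpExtension
  Summit.BirchSwinnertonDyer.Rank1Residual Summit.BirchSwinnertonDyer.Rank1Residual.Additive
  Summit.BirchSwinnertonDyer.Rank1Residual.O6
  Summit.BirchSwinnertonDyer.BirchSwinnertonDyer.Theorems

/-- **THE FINE UNIT-ANCHOR ROAD, Tamagawa form, at an additive potentially-good odd prime (K8-t′ twin).**
`W/ℚ` globally minimal, `r_an = 0`, `p` odd, `Addv W p`, `0 ≤ ord_p j`, `W[p]` irreducible; `W′` elliptic over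
`ℚ` with `W′[p] ≅ W[p]` (ANY reduction at `p`), a finite `S` off which `W′` is good and `v ∤ p`,
`rank W′(ℚ) = 0`, `#Ш(W′/ℚ)[p^∞] = 1`, `p ∤ ∏ c_ℓ(W′)`, and no non-zero `D_v`-fixed `p`-torsion of `W′[p^∞]` at the
`v ∈ S` above `p`. Then `MissingUpperBoundAt W p`. [cite: GreenbergLNM1716, Prop. 3.8 (pp. 95–96) and §3 Lemma 3.3]
[cite: LimSujatha2018, §3 Prop. 3.2] [cite: Kato2004Asterisque, Thm. 14.5 (3) (p. 236) and Prop. 14.16 (2) (p. 244)] -/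
theorem missingUpperBoundAt_addv_of_fineUnitAnchor_tamagawa
    (hLS : LimSujatha2018.prop32_fineSelmerDual_moduleFinite_iff_of_torsionIso)
    (hKatoA :
      Kato2004.rankZero_padicValNat_sha_add_padicValNat_tamagawa_le_of_additive_potGood_of_irreducible_of_fineSelmerDual_fg)
    (hGZK : rank_eq_analyticRank_of_analyticRank_le_one) (hmod : hasEntireLFunction_rat)
    (W : WeierstrassCurve ℚ) [W.IsElliptic] [W.IsGloballyMinimal] (p : ℕ) [Fact p.Prime]
    (hr : W.analyticRank = 0) (hp : p ≠ 2) (hA : Addv W p) (hj : 0 ≤ padicValRat p W.j)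
    (hirr : W.HasIrreducibleModPGaloisRep p)
    (W' : WeierstrassCurve ℚ) [W'.IsElliptic] (hcong : ModPCongruent W' W p)
    (S : Finset (HeightOneSpectrum (𝓞 ℚ)))
    (hS : ∀ v ∉ S, ((p : ℕ) : 𝓞 ℚ) ∉ v.asIdeal ∧ W'.HasGoodReductionAt v)
    (hrank' : W'.mordellWeilRank = 0) (hsha' : Nat.card (AddCommGroup.primaryComponent W'.sha p) = 1)
    (htam' : ¬ p ∣ W'.tamagawaProduct)
    (hlocp : ∀ v ∈ S, ((p : ℕ) : 𝓞 ℚ) ∈ v.asIdeal →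
      ∀ x : W'.geomPrimaryTorsion p, p • x = 0 → (∀ d ∈ decomp v, d • x = x) → x = 0) :
    MissingUpperBoundAt W p :=
  TameFineSelmerSupersingularUnitAnchor.missingUpperBoundAt_addv_of_conjA hKatoA hGZK hmod W p hr hp hA hj
    hirr
    (WildFineSelmerCongruenceFact.conjA_of_modPCongruent hLS hp hcong
      (WildFineSelmerFineUnitAnchorTamagawa.conjA_rat_of_fineUnitData_tamagawa W' S hS hrank' hsha' htam'
        hlocp))

/-- **The same with the anchor's global data in PRINTED form**: `r_an(W′) = 0`, `p ∤ #Ш(W′/ℚ)`,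
`p ∤ ∏ c_ℓ(W′)`. [cite: GreenbergLNM1716, Prop. 3.8 (pp. 95–96)] [cite: LimSujatha2018, §3 Prop. 3.2] -/
theorem missingUpperBoundAt_addv_of_fineUnitAnchor_tamagawa_analytic
    (hLS : LimSujatha2018.prop32_fineSelmerDual_moduleFinite_iff_of_torsionIso)
    (hKatoA :
      Kato2004.rankZero_padicValNat_sha_add_padicValNat_tamagawa_le_of_additive_potGood_of_irreducible_of_fineSelmerDual_fg)
    (hGZK : rank_eq_analyticRank_of_analyticRank_le_one) (hmod : hasEntireLFunction_rat)
    (W : WeierstrassCurve ℚ) [W.IsElliptic] [W.IsGloballyMinimal] (p : ℕ) [Fact p.Prime]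
    (hr : W.analyticRank = 0) (hp : p ≠ 2) (hA : Addv W p) (hj : 0 ≤ padicValRat p W.j)
    (hirr : W.HasIrreducibleModPGaloisRep p)
    (W' : WeierstrassCurve ℚ) [W'.IsElliptic] (hcong : ModPCongruent W' W p)
    (S : Finset (HeightOneSpectrum (𝓞 ℚ)))
    (hS : ∀ v ∉ S, ((p : ℕ) : 𝓞 ℚ) ∉ v.asIdeal ∧ W'.HasGoodReductionAt v)
    (hr' : W'.analyticRank = 0) (hsha' : ¬ p ∣ Nat.card W'.sha) (htam' : ¬ p ∣ W'.tamagawaProduct)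
    (hlocp : ∀ v ∈ S, ((p : ℕ) : 𝓞 ℚ) ∈ v.asIdeal →
      ∀ x : W'.geomPrimaryTorsion p, p • x = 0 → (∀ d ∈ decomp v, d • x = x) → x = 0) :
    MissingUpperBoundAt W p := by
  obtain ⟨hmw, hfin⟩ := hGZK W' (by rw [hr']; exact zero_le_one)
  haveI : Finite W'.sha := hfin
  have hrank' : W'.mordellWeilRank = 0 := by rw [hmw, hr']
  have h1 : Nat.card (AddCommGroup.primaryComponent W'.sha p) = 1 := by
    rw [card_addPrimaryComponent_eq_pow p, Nat.factorization_eq_zero_of_not_dvd hsha', pow_zero]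
  exact missingUpperBoundAt_addv_of_fineUnitAnchor_tamagawa hLS hKatoA hGZK hmod W p hr hp hA hj hirr W' hcong
    S hS hrank' h1 htam' hlocp

/-- **The (t′) crux body from per-row fine TAMAGAWA-anchor certificates** (class form). Conditional on `hLS`
only; the item is NOT closed. [cite: LimSujatha2018, §3 Prop. 3.2] [cite: GreenbergLNM1716, Prop. 3.8 (pp. 95–96)] -/
theorem tameFineSelmerCoatesSujatha_of_fineTamagawaAnchorCertificates
    (hLS : LimSujatha2018.prop32_fineSelmerDual_moduleFinite_iff_of_torsionIso)
    (hcert : ∀ (W : WeierstrassCurve ℚ) [W.IsElliptic] [W.IsGloballyMinimal] (p : ℕ) [Fact p.Prime],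
      W.analyticRank = 0 → p ≠ 2 → Addv W p → SubTprime W p → W.HasIrreducibleModPGaloisRep p →
      ¬ (∀ n : ℕ, W.HasSurjectiveModNGaloisRep (p ^ n : ℕ)) → ¬ W.HasCM →
      ∃ (W' : WeierstrassCurve ℚ) (_ : W'.IsElliptic) (S : Finset (HeightOneSpectrum (𝓞 ℚ))),
        ModPCongruent W' W p ∧ (∀ v ∉ S, ((p : ℕ) : 𝓞 ℚ) ∉ v.asIdeal ∧ W'.HasGoodReductionAt v) ∧
        W'.mordellWeilRank = 0 ∧ Nat.card (AddCommGroup.primaryComponent W'.sha p) = 1 ∧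
        ¬ p ∣ W'.tamagawaProduct ∧
        (∀ v ∈ S, ((p : ℕ) : 𝓞 ℚ) ∈ v.asIdeal →
          ∀ x : W'.geomPrimaryTorsion p, p • x = 0 → (∀ d ∈ decomp v, d • x = x) → x = 0)) :
    ∀ (W : WeierstrassCurve ℚ) [W.IsElliptic] [W.IsGloballyMinimal] (p : ℕ) [Fact p.Prime],
      W.analyticRank = 0 → p ≠ 2 → Addv W p → SubTprime W p → W.HasIrreducibleModPGaloisRep p →
      ¬ (∀ n : ℕ, W.HasSurjectiveModNGaloisRep (p ^ n : ℕ)) → ¬ W.HasCM →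
      ∀ (κ : ZpExtension ℚ p), κ.IsCyclotomic →
        ∃ (γ : absoluteGaloisGroup ℚ) (D : W.FineSelmerDualData κ γ),
          Module.Finite ℤ_[p] (RestrictScalars ℤ_[p] (IwasawaAlgebra p) D.X) := by
  refine TameFineSelmerOrdinaryAnchor.tameFineSelmerCoatesSujatha_of_mixedCertificates hLS
    fun W _ _ p _ hr hp hA hT hirr hns hcm ↦ ?_
  obtain ⟨W', hW'e, S, hcong, hS, hrank', hsha', htam', hlocp⟩ := hcert W p hr hp hA hT hirr hns hcm
  haveI := hW'e
  exact ⟨W', hW'e, hcong, Or.inl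
    (WildFineSelmerFineUnitAnchorTamagawa.conjA_rat_of_fineUnitData_tamagawa W' S hS hrank' hsha' htam'
      hlocp)⟩

end Summit.BirchSwinnertonDyer.BirchSwinnertonDyer.Theorems.TameFineSelmerFineUnitAnchorTamagawa

end
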